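import Summits.HodgeConjecture.HodgeConjecture.Theses.NikulinTwinTransport
import Summits.HodgeConjecture.HodgeConjecture.Theorems.NikulinSerreCarrier.Negative.OrientationTwist
import Literature.AlgebraicGeometry.Surfaces.K3Surface
import Literature.AlgebraicGeometry.Surfaces.K3NikulinInvolution
import Literature.AlgebraicGeometry.HodgeTheory.AnalytifiedVectorBundle
import Literature.AlgebraicGeometry.HodgeTheory.KaehlerClassHodgeType
import Literature.AlgebraicGeometry.HodgeTheory.ChernCharacterBetti
import Literature.Geometry.Hyperkaehler.Hyperholomorphic

/-!
# The typed transcription of crux `NikulinSerreCarrier` is false for every Chern character theory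
# (orientation-family twist) — stmt-HodgeConjecture-14464, negative side

Negative side of crux `NikulinSerreCarrier` (stmt-HodgeConjecture-14464, route NikulinTwinTransport), by the
standing disprover (cdisprove gen 3).  The route item is INFORMAL; the crux-plan planner's TYPED TRANSCRIPTION
`Summit.HodgeConjecture.HodgeConjecture.Cruxes.NikulinSerreCarrier.NikulinSerreCarrier` (work-file
`Cruxes/NikulinSerreCarrier/TypedCrux.lean` v2, inlined verbatim in the registered skeleton
`Lines/modular-twin-address.lean`, skeleton sha `b572748113740b24…`, and offered as the item signature) reads

  `∀ μ : OrientationFamily, μ.HasPoincareDuality → ∀ C : ChernCharacterBetti, ∃ (anchor data) (G) …,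
     … ∧ (∃ m : ℤ, m ≠ 0 ∧ ∀ y, fst_*^μ (snd^* y ∪ ch₂ G) = (−m) • Ψ y) ∧ …`.

THIS FILE PROVES IT FALSE for every `C` at ONE admissible `μ` (hence false outright as soon as
`ChernCharacterBetti` is inhabited, and provable only if `ChernCharacterBetti` is EMPTY):
`OrientationFamily` is an arbitrary family of `ℂ`-orientations of the manifolds `X(ℂ)` and Poincaré
duality holds for all of them (`OrientationFamily.hasPoincareDuality`), while `complexGysin μ` rescales by
`λ_source/λ_target` when the fundamental classes are rescaled (`gysinMap_eq_smul_of_fundamentalClass_eq`).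
The family `twistFamily` (`Negative/OrientationTwist`: `[X(ℂ)] = I^{dim X / 2} • ι_*[X(ℂ)]_ℚ`) makes every
codimension-two Gysin morphism `I •` a rationality-preserving map, and an INTEGER (indeed any real) non-zero
multiple of the rational map `Ψ` cannot equal `I •` a rational-valued map unless `Ψ` kills all rational
classes — which the anchor clauses (`Ψ N_j = r_j`, `(r_j.r_j) = −4·pX`, `pX` an integral generator of `H⁴`)
forbid, `H⁴(X(ℂ); ℂ)` having a non-zero integral class.

CLASSIFICATION (refuter): `refuted-misstated` FOR THE TYPED TRANSCRIPTION (not for the informal item): the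
witness exploits a missing normalisation — the integer `m` is meaningful only for the complex (or any
rationally normalised) orientation, whereas the statement quantifies over all `μ`.  Minimal repairs, either of
which the witness MISSES: (C′₁) replace `∃ m : ℤ, m ≠ 0 ∧ …` by `∃ m : ℂ, m ≠ 0 ∧ …` (scale-invariant, and what
crux K2 consumes: a non-zero multiple of `Ψ`); or (C′₂) keep `m : ℤ` but quantify over rationally normalised
families only (`∀ μ, (∀ X hX, ∃ ν : HomologicalOrientation ℚ …, ι_*[X(ℂ)]_ν = [X(ℂ)]_{μ hX}) → …`; such
families exist: `ratFamily`).  The same defect, with the same repair, sits in the registered stub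
`stub_modularTwinAddress` (address equation `= (−2m) • y`, `m : ℤ`; refuted alongside in
`Negative/StubModularTwinAddressFalse`) and in the conclusion `∃ m' : ℤ` of `stub_mixedClassTransfer`.

## References

* [FultonYoungTableaux1997] W. Fulton, Young Tableaux, CUP 1997, App. B §B.1 (4)–(5) (Gysin maps from
  Poincaré duality; dependence on the orientation).
* [HatcherAT2002] A. Hatcher, Algebraic Topology, CUP 2002, §3.1 Thm. 3.2, §3.3 Thm. 3.26, Thm. 3.30.
* [VoisinHodgeI2002] C. Voisin, Hodge Theory and Complex Algebraic Geometry I, CUP 2002, §7.1.1, §7.3.2,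
  Cor. 6.12 (rational classes are real).
* [Buskin2019] N. Buskin, Every rational Hodge isometry between two K3 surfaces is algebraic, J. reine
  angew. Math. 755 (2019) — the route's engine, for context only.
-/

noncomputable section

open scoped Manifold ContDiff
open CategoryTheory MonoidalCategory
open Literature.AlgebraicGeometry Literature.AlgebraicGeometry.HodgeTheory
open Literature.AlgebraicGeometry.Surfaces Literature.AlgebraicGeometry.Motives
open Literature.AlgebraicTopology.SingularHomology
open Literature.Geometry.Hyperkaehler Literature.Geometry.Kaehler
open Literature.NumberTheory.Transcendental (DeRhamIsoFamily)
open Summit.HodgeConjecture.HodgeConjecture.Theorems.NikulinSerreCarrier.Negative.OrientationTwist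

namespace Summit.HodgeConjecture.HodgeConjecture.Theorems.NikulinSerreCarrier.Negative.TypedCruxFalse

/-- **No Chern character theory admits the typed-crux data for the twisted orientation family.**
The statement is the body of the typed crux `Cruxes.NikulinSerreCarrier.NikulinSerreCarrier` VERBATIM with
`μ := twistFamily` (two occurrences of `complexGysin μ`).  Proof: for rational `y`,
`fst_*^{tw}(snd^* y ∪ ch₂ G) = I • fst_*^{rat}(…)` is `I •` a rational class (`ch₂ G` rational by the field
`isRationalClass_ch`; `complexGysin_twistFamily_of_add_two`, `isRationalClass_complexGysin_ratFamily`), and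
`= (−m) • Ψ y` with `Ψ y` rational, `m ∈ ℤ ∖ 0`; conjugation gives `Ψ y = 0` (`eq_zero_of_I_smul_eq_smul`).
So `r_j = Ψ N_j = 0`, `(r₀.r₀) = −4 • pX` gives `pX = 0`, and the generator clause makes every integral class
of `H⁴(X(ℂ); ℂ)` vanish, against `exists_isIntegralClass_ne_zero_top`. [folklore] -/
theorem typedNikulinSerreCarrier_twistFamily_false (C : ChernCharacterBetti) :
    ¬ (
      ∃ (X Y : SchemeOver ℂ) (hX : IsK3Surface X) (hY : IsK3Surface Y)
        (pX : complexBetti X (2 * 2)) (pY : complexBetti Y (2 * 2)) (ι : X ⟶ X)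
        (N : Fin 8 → complexBetti Y (2 * 1)) (h : complexBetti Y (2 * 1)) (r : Fin 8 → complexBetti X (2 * 1))
        (Ψ : complexBetti Y (2 * 1) →ₗ[ℂ] complexBetti X (2 * 1)),
        -- X carries the Nikulin involution ι; pX, pY are integral generators of H⁴
        IsNikulinInvolution X ι ∧
        (IsIntegralClass pX ∧ ∀ q : complexBetti X (2 * 2), IsIntegralClass q → ∃ n : ℤ, q = n • pX) ∧
        (IsIntegralClass pY ∧ ∀ q : complexBetti Y (2 * 2), IsIntegralClass q → ∃ n : ℤ, q = n • pY) ∧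
        -- the eight nodal classes and the even eight
        (∀ j, IsIntegralClass (N j) ∧ N j ∈ algebraicClasses Y 1) ∧
        (∀ i j, cupProduct (rfl : 2 * 1 + 2 * 1 = 2 * 2) (N i) (N j) =
          (if i = j then (-2 : ℂ) else 0) • pY) ∧
        IsIntegralClass ((1 / 2 : ℂ) • ∑ j, N j) ∧
        -- the class h (pull-back of an ample class of X/ι): integral, algebraic, h ⊥ Nⱼ, h² = 2d > 0
        (IsIntegralClass h ∧ h ∈ algebraicClasses Y 1) ∧
        (∀ j, cupProduct (rfl : 2 * 1 + 2 * 1 = 2 * 2) h (N j) = 0) ∧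
        (∃ d : ℕ, 0 < d ∧ cupProduct (rfl : 2 * 1 + 2 * 1 = 2 * 2) h h = ((2 * d : ℕ) : ℂ) • pY) ∧
        -- the eight roots rⱼ of E₈(−2) ⊂ NS(X): integral, algebraic, ι-anti-invariant, (rᵢ.rⱼ) = −4δᵢⱼ
        (∀ j, IsIntegralClass (r j) ∧ r j ∈ algebraicClasses X 1 ∧
          complexBetti.map ι (2 * 1) (r j) = -r j) ∧
        (∀ i j, cupProduct (rfl : 2 * 1 + 2 * 1 = 2 * 2) (r i) (r j) =
          (if i = j then (-4 : ℂ) else 0) • pX) ∧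
        -- the completed Nikulin 2-similitude Ψ: rational, type-preserving, (Ψx.Ψy) = 2(x.y), bijective,
        -- Ψ Nⱼ = rⱼ, ι^*-invariant on N^⊥ (= g^* there)
        (∀ x, IsRationalClass x → IsRationalClass (Ψ x)) ∧
        (∀ (i j : ℕ) (x : complexBetti Y (2 * 1)),
          IsOfHodgeType 2 Y (2 * 1) i j x → IsOfHodgeType 2 X (2 * 1) i j (Ψ x)) ∧
        (∀ (x y : complexBetti Y (2 * 1)) (a : ℂ),
          cupProduct (rfl : 2 * 1 + 2 * 1 = 2 * 2) x y = a • pY →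
          cupProduct (rfl : 2 * 1 + 2 * 1 = 2 * 2) (Ψ x) (Ψ y) = ((2 : ℂ) * a) • pX) ∧
        Function.Bijective Ψ ∧
        (∀ j, Ψ (N j) = r j) ∧
        (∀ x : complexBetti Y (2 * 1), (∀ j, cupProduct (rfl : 2 * 1 + 2 * 1 = 2 * 2) x (N j) = 0) →
          complexBetti.map ι (2 * 1) (Ψ x) = Ψ x) ∧
        -- ALGEBRAIC AT THE ANCHOR: Ψ = [γ₀]_* for an algebraic class γ₀ on X ⊗ Y
        (∃ γ₀ ∈ algebraicClasses (X ⊗ Y) 2, ∀ x : complexBetti Y (2 * 1),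
          Ψ x = complexGysin twistFamily (IsSmoothProjective.tensor_holds hX.1 hY.1) hX.1
            (SemiCartesianMonoidalCategory.fst X Y)
            (rfl : 2 * 1 + 2 * 2 + 2 * 2 = 2 * 1 + 2 * (2 + 2))
            (cupProduct (rfl : 2 * 1 + 2 * 2 = 2 * 1 + 2 * 2)
              (complexBetti.map (SemiCartesianMonoidalCategory.snd X Y) (2 * 1) x) γ₀)) ∧
        ∃ ε : Fin 8 → ℝ, (∀ j, 0 < ε j) ∧
        ∃ ω' : complexBetti Y (2 * 1), ω' = h - ∑ j, ((ε j : ℝ) : ℂ) • N j ∧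
        ∃ (G : (X ⊗ Y).left.Modules) (rk : ℕ), IsVectorBundle G ∧ C.ch (X ⊗ Y) G 1 = 0 ∧
          (∃ m : ℤ, m ≠ 0 ∧ ∀ y : complexBetti Y (2 * 1),
            complexGysin twistFamily (IsSmoothProjective.tensor_holds hX.1 hY.1) hX.1
              (SemiCartesianMonoidalCategory.fst X Y)
              (rfl : 2 * 1 + 2 * 2 + 2 * 2 = 2 * 1 + 2 * (2 + 2))
              (cupProduct (rfl : 2 * 1 + 2 * 2 = 2 * 1 + 2 * 2)
                (complexBetti.map (SemiCartesianMonoidalCategory.snd X Y) (2 * 1) y)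
                (C.ch (X ⊗ Y) G 2)) =
            (-(m : ℂ)) • Ψ y) ∧
          ∃ (A : HodgeModel (2 + 2) (X ⊗ Y))
            (𝓕 : AnalytifiedVectorBundle 𝓘(ℂ, A.model) (EuclideanSpace ℂ (Fin rk)) A.toComplexPoints
              G)
            (gm : Bundle.ContMDiffRiemannianMetric 𝓘(ℝ, A.model) ∞ A.model
              (fun x : A.carrier ↦ TangentSpace 𝓘(ℝ, A.model) x))
            (J K : ∀ x : A.carrier, TangentSpace 𝓘(ℝ, A.model) x →L[ℝ] TangentSpace 𝓘(ℝ, A.model) x)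
            (hHK : IsHyperkaehlerTriple gm.toRiemannianMetric J K)
            (hω : isSmoothForm_kaehlerForm_of_isManifold_complex (E := A.model) (M := A.carrier))
            (e : DeRhamIsoFamily 𝓘(ℝ, A.model)),
            e.IsNatural ∧
            A.pullback 2
                (complexBetti.map (SemiCartesianMonoidalCategory.fst X Y) (2 * 1) (Ψ ω') +
                  complexBetti.map (SemiCartesianMonoidalCategory.snd X Y) (2 * 1) (ω')) =
              ofRealClass A.carrier 2 (e A.carrier 2 (gm.kaehlerClass hω hHK.isKaehler)) ∧
            HasHyperholomorphicConnection (EuclideanSpace ℂ (Fin rk)) 𝓕.bundle J K) := by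
  rintro ⟨X, Y, hX, hY, pX, pY, ι, N, h, r, Ψ, -, hpX, -, hN, -, -, -, -, -, -, hrr, hΨrat,
      -, -, -, hΨN, -, -, ε, -, ω', -, G, rk, hG, -, ⟨m, hm, hact⟩, -⟩
  -- Step 1: `Ψ y = 0` for every rational `y`.
  have key : ∀ y : complexBetti Y (2 * 1), IsRationalClass y → Ψ y = 0 := by
    intro y hy
    have hw : IsRationalClass (cupProduct (rfl : 2 * 1 + 2 * 2 = 2 * 1 + 2 * 2)
        (complexBetti.map (SemiCartesianMonoidalCategory.snd X Y) (2 * 1) y) (C.ch (X ⊗ Y) G 2)) :=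
      (hy.map _).cup _ (C.isRationalClass_ch _ G hG 2)
    have e := hact y
    rw [complexGysin_twistFamily_of_add_two, LinearMap.smul_apply] at e
    exact eq_zero_of_I_smul_eq_smul (isRationalClass_complexGysin_ratFamily _ _ _ _ hw) (hΨrat y hy)
      (by simp) (neg_ne_zero.2 (Int.cast_ne_zero.2 hm)) e
  -- Step 2: `r_j = 0`, hence `pX = 0`.
  have hr0 : ∀ j, r j = 0 := fun j ↦ by
    rw [← hΨN j]
    exact key _ (hN j).1.isRationalClass
  have hpX0 : pX = 0 := by
    have e := hrr 0 0
    rw [hr0, map_zero] at e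
    simp only [if_true] at e
    exact (smul_eq_zero.1 e.symm).resolve_left (by norm_num)
  -- Step 3: every integral class of `H⁴(X(ℂ); ℂ)` would vanish.
  obtain ⟨q, hq, hq0⟩ := exists_isIntegralClass_ne_zero_top hX.1
  obtain ⟨k, hk⟩ := hpX.2 q hq
  exact hq0 (by rw [hk, hpX0, smul_zero])

/-- **The typed crux `NikulinSerreCarrier` (VERBATIM: textually identical to `def NikulinSerreCarrier : Prop`
of `Cruxes/NikulinSerreCarrier/TypedCrux.lean` v2 = the copy inlined in the registered skeleton
`Lines/modular-twin-address.lean`, so `rfl` identifies them in any file elaborating both) is FALSE as soon as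
one Chern character theory on the real carrier exists** — negative lemma modulo
`H := Nonempty ChernCharacterBetti` (the standard Chern character, Fulton Ex. 3.2.3 / Voisin Thm. 11.23,
whose CONSTRUCTION the tree does not have; no named existence fact exists by design).
Refuter class for the typed transcription: misstated — repair `m : ℂ` (or rationally normalised `μ`), see
the module docstring. [cite: Fulton1998, Example 3.2.3] -/
theorem typedNikulinSerreCarrier_false_of_nonempty_chernCharacterBetti (hC : Nonempty ChernCharacterBetti) :
    ¬ (
    ∀ (μ : OrientationFamily), μ.HasPoincareDuality → ∀ (C : ChernCharacterBetti),
      ∃ (X Y : SchemeOver ℂ) (hX : IsK3Surface X) (hY : IsK3Surface Y)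
        (pX : complexBetti X (2 * 2)) (pY : complexBetti Y (2 * 2)) (ι : X ⟶ X)
        (N : Fin 8 → complexBetti Y (2 * 1)) (h : complexBetti Y (2 * 1)) (r : Fin 8 → complexBetti X (2 * 1))
        (Ψ : complexBetti Y (2 * 1) →ₗ[ℂ] complexBetti X (2 * 1)),
        -- X carries the Nikulin involution ι; pX, pY are integral generators of H⁴
        IsNikulinInvolution X ι ∧
        (IsIntegralClass pX ∧ ∀ q : complexBetti X (2 * 2), IsIntegralClass q → ∃ n : ℤ, q = n • pX) ∧
        (IsIntegralClass pY ∧ ∀ q : complexBetti Y (2 * 2), IsIntegralClass q → ∃ n : ℤ, q = n • pY) ∧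
        -- the eight nodal classes and the even eight
        (∀ j, IsIntegralClass (N j) ∧ N j ∈ algebraicClasses Y 1) ∧
        (∀ i j, cupProduct (rfl : 2 * 1 + 2 * 1 = 2 * 2) (N i) (N j) =
          (if i = j then (-2 : ℂ) else 0) • pY) ∧
        IsIntegralClass ((1 / 2 : ℂ) • ∑ j, N j) ∧
        -- the class h (pull-back of an ample class of X/ι): integral, algebraic, h ⊥ Nⱼ, h² = 2d > 0
        (IsIntegralClass h ∧ h ∈ algebraicClasses Y 1) ∧
        (∀ j, cupProduct (rfl : 2 * 1 + 2 * 1 = 2 * 2) h (N j) = 0) ∧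
        (∃ d : ℕ, 0 < d ∧ cupProduct (rfl : 2 * 1 + 2 * 1 = 2 * 2) h h = ((2 * d : ℕ) : ℂ) • pY) ∧
        -- the eight roots rⱼ of E₈(−2) ⊂ NS(X): integral, algebraic, ι-anti-invariant, (rᵢ.rⱼ) = −4δᵢⱼ
        (∀ j, IsIntegralClass (r j) ∧ r j ∈ algebraicClasses X 1 ∧
          complexBetti.map ι (2 * 1) (r j) = -r j) ∧
        (∀ i j, cupProduct (rfl : 2 * 1 + 2 * 1 = 2 * 2) (r i) (r j) =
          (if i = j then (-4 : ℂ) else 0) • pX) ∧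
        -- the completed Nikulin 2-similitude Ψ: rational, type-preserving, (Ψx.Ψy) = 2(x.y), bijective,
        -- Ψ Nⱼ = rⱼ, ι^*-invariant on N^⊥ (= g^* there)
        (∀ x, IsRationalClass x → IsRationalClass (Ψ x)) ∧
        (∀ (i j : ℕ) (x : complexBetti Y (2 * 1)),
          IsOfHodgeType 2 Y (2 * 1) i j x → IsOfHodgeType 2 X (2 * 1) i j (Ψ x)) ∧
        (∀ (x y : complexBetti Y (2 * 1)) (a : ℂ),
          cupProduct (rfl : 2 * 1 + 2 * 1 = 2 * 2) x y = a • pY →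
          cupProduct (rfl : 2 * 1 + 2 * 1 = 2 * 2) (Ψ x) (Ψ y) = ((2 : ℂ) * a) • pX) ∧
        Function.Bijective Ψ ∧
        (∀ j, Ψ (N j) = r j) ∧
        (∀ x : complexBetti Y (2 * 1), (∀ j, cupProduct (rfl : 2 * 1 + 2 * 1 = 2 * 2) x (N j) = 0) →
          complexBetti.map ι (2 * 1) (Ψ x) = Ψ x) ∧
        -- ALGEBRAIC AT THE ANCHOR: Ψ = [γ₀]_* for an algebraic class γ₀ on X ⊗ Y
        (∃ γ₀ ∈ algebraicClasses (X ⊗ Y) 2, ∀ x : complexBetti Y (2 * 1),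
          Ψ x = complexGysin μ (IsSmoothProjective.tensor_holds hX.1 hY.1) hX.1
            (SemiCartesianMonoidalCategory.fst X Y)
            (rfl : 2 * 1 + 2 * 2 + 2 * 2 = 2 * 1 + 2 * (2 + 2))
            (cupProduct (rfl : 2 * 1 + 2 * 2 = 2 * 1 + 2 * 2)
              (complexBetti.map (SemiCartesianMonoidalCategory.snd X Y) (2 * 1) x) γ₀)) ∧
        ∃ ε : Fin 8 → ℝ, (∀ j, 0 < ε j) ∧
        ∃ ω' : complexBetti Y (2 * 1), ω' = h - ∑ j, ((ε j : ℝ) : ℂ) • N j ∧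
        ∃ (G : (X ⊗ Y).left.Modules) (rk : ℕ), IsVectorBundle G ∧ C.ch (X ⊗ Y) G 1 = 0 ∧
          (∃ m : ℤ, m ≠ 0 ∧ ∀ y : complexBetti Y (2 * 1),
            complexGysin μ (IsSmoothProjective.tensor_holds hX.1 hY.1) hX.1
              (SemiCartesianMonoidalCategory.fst X Y)
              (rfl : 2 * 1 + 2 * 2 + 2 * 2 = 2 * 1 + 2 * (2 + 2))
              (cupProduct (rfl : 2 * 1 + 2 * 2 = 2 * 1 + 2 * 2)
                (complexBetti.map (SemiCartesianMonoidalCategory.snd X Y) (2 * 1) y)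
                (C.ch (X ⊗ Y) G 2)) =
            (-(m : ℂ)) • Ψ y) ∧
          ∃ (A : HodgeModel (2 + 2) (X ⊗ Y))
            (𝓕 : AnalytifiedVectorBundle 𝓘(ℂ, A.model) (EuclideanSpace ℂ (Fin rk)) A.toComplexPoints
              G)
            (gm : Bundle.ContMDiffRiemannianMetric 𝓘(ℝ, A.model) ∞ A.model
              (fun x : A.carrier ↦ TangentSpace 𝓘(ℝ, A.model) x))
            (J K : ∀ x : A.carrier, TangentSpace 𝓘(ℝ, A.model) x →L[ℝ] TangentSpace 𝓘(ℝ, A.model) x)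
            (hHK : IsHyperkaehlerTriple gm.toRiemannianMetric J K)
            (hω : isSmoothForm_kaehlerForm_of_isManifold_complex (E := A.model) (M := A.carrier))
            (e : DeRhamIsoFamily 𝓘(ℝ, A.model)),
            e.IsNatural ∧
            A.pullback 2
                (complexBetti.map (SemiCartesianMonoidalCategory.fst X Y) (2 * 1) (Ψ ω') +
                  complexBetti.map (SemiCartesianMonoidalCategory.snd X Y) (2 * 1) (ω')) =
              ofRealClass A.carrier 2 (e A.carrier 2 (gm.kaehlerClass hω hHK.isKaehler)) ∧
            HasHyperholomorphicConnection (EuclideanSpace ℂ (Fin rk)) 𝓕.bundle J K) := fun H ↦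
  typedNikulinSerreCarrier_twistFamily_false hC.some (H twistFamily (OrientationFamily.hasPoincareDuality _) hC.some)

/-- Equivalently: **the typed crux can only hold vacuously** — it implies that NO Chern character theory
with values in `H²*(–(ℂ); ℂ)` exists. [folklore] -/
theorem isEmpty_chernCharacterBetti_of_typedNikulinSerreCarrier (H :
    ∀ (μ : OrientationFamily), μ.HasPoincareDuality → ∀ (C : ChernCharacterBetti),
      ∃ (X Y : SchemeOver ℂ) (hX : IsK3Surface X) (hY : IsK3Surface Y)
        (pX : complexBetti X (2 * 2)) (pY : complexBetti Y (2 * 2)) (ι : X ⟶ X)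
        (N : Fin 8 → complexBetti Y (2 * 1)) (h : complexBetti Y (2 * 1)) (r : Fin 8 → complexBetti X (2 * 1))
        (Ψ : complexBetti Y (2 * 1) →ₗ[ℂ] complexBetti X (2 * 1)),
        -- X carries the Nikulin involution ι; pX, pY are integral generators of H⁴
        IsNikulinInvolution X ι ∧
        (IsIntegralClass pX ∧ ∀ q : complexBetti X (2 * 2), IsIntegralClass q → ∃ n : ℤ, q = n • pX) ∧
        (IsIntegralClass pY ∧ ∀ q : complexBetti Y (2 * 2), IsIntegralClass q → ∃ n : ℤ, q = n • pY) ∧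
        -- the eight nodal classes and the even eight
        (∀ j, IsIntegralClass (N j) ∧ N j ∈ algebraicClasses Y 1) ∧
        (∀ i j, cupProduct (rfl : 2 * 1 + 2 * 1 = 2 * 2) (N i) (N j) =
          (if i = j then (-2 : ℂ) else 0) • pY) ∧
        IsIntegralClass ((1 / 2 : ℂ) • ∑ j, N j) ∧
        -- the class h (pull-back of an ample class of X/ι): integral, algebraic, h ⊥ Nⱼ, h² = 2d > 0
        (IsIntegralClass h ∧ h ∈ algebraicClasses Y 1) ∧
        (∀ j, cupProduct (rfl : 2 * 1 + 2 * 1 = 2 * 2) h (N j) = 0) ∧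
        (∃ d : ℕ, 0 < d ∧ cupProduct (rfl : 2 * 1 + 2 * 1 = 2 * 2) h h = ((2 * d : ℕ) : ℂ) • pY) ∧
        -- the eight roots rⱼ of E₈(−2) ⊂ NS(X): integral, algebraic, ι-anti-invariant, (rᵢ.rⱼ) = −4δᵢⱼ
        (∀ j, IsIntegralClass (r j) ∧ r j ∈ algebraicClasses X 1 ∧
          complexBetti.map ι (2 * 1) (r j) = -r j) ∧
        (∀ i j, cupProduct (rfl : 2 * 1 + 2 * 1 = 2 * 2) (r i) (r j) =
          (if i = j then (-4 : ℂ) else 0) • pX) ∧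
        -- the completed Nikulin 2-similitude Ψ: rational, type-preserving, (Ψx.Ψy) = 2(x.y), bijective,
        -- Ψ Nⱼ = rⱼ, ι^*-invariant on N^⊥ (= g^* there)
        (∀ x, IsRationalClass x → IsRationalClass (Ψ x)) ∧
        (∀ (i j : ℕ) (x : complexBetti Y (2 * 1)),
          IsOfHodgeType 2 Y (2 * 1) i j x → IsOfHodgeType 2 X (2 * 1) i j (Ψ x)) ∧
        (∀ (x y : complexBetti Y (2 * 1)) (a : ℂ),
          cupProduct (rfl : 2 * 1 + 2 * 1 = 2 * 2) x y = a • pY →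
          cupProduct (rfl : 2 * 1 + 2 * 1 = 2 * 2) (Ψ x) (Ψ y) = ((2 : ℂ) * a) • pX) ∧
        Function.Bijective Ψ ∧
        (∀ j, Ψ (N j) = r j) ∧
        (∀ x : complexBetti Y (2 * 1), (∀ j, cupProduct (rfl : 2 * 1 + 2 * 1 = 2 * 2) x (N j) = 0) →
          complexBetti.map ι (2 * 1) (Ψ x) = Ψ x) ∧
        -- ALGEBRAIC AT THE ANCHOR: Ψ = [γ₀]_* for an algebraic class γ₀ on X ⊗ Y
        (∃ γ₀ ∈ algebraicClasses (X ⊗ Y) 2, ∀ x : complexBetti Y (2 * 1),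
          Ψ x = complexGysin μ (IsSmoothProjective.tensor_holds hX.1 hY.1) hX.1
            (SemiCartesianMonoidalCategory.fst X Y)
            (rfl : 2 * 1 + 2 * 2 + 2 * 2 = 2 * 1 + 2 * (2 + 2))
            (cupProduct (rfl : 2 * 1 + 2 * 2 = 2 * 1 + 2 * 2)
              (complexBetti.map (SemiCartesianMonoidalCategory.snd X Y) (2 * 1) x) γ₀)) ∧
        ∃ ε : Fin 8 → ℝ, (∀ j, 0 < ε j) ∧
        ∃ ω' : complexBetti Y (2 * 1), ω' = h - ∑ j, ((ε j : ℝ) : ℂ) • N j ∧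
        ∃ (G : (X ⊗ Y).left.Modules) (rk : ℕ), IsVectorBundle G ∧ C.ch (X ⊗ Y) G 1 = 0 ∧
          (∃ m : ℤ, m ≠ 0 ∧ ∀ y : complexBetti Y (2 * 1),
            complexGysin μ (IsSmoothProjective.tensor_holds hX.1 hY.1) hX.1
              (SemiCartesianMonoidalCategory.fst X Y)
              (rfl : 2 * 1 + 2 * 2 + 2 * 2 = 2 * 1 + 2 * (2 + 2))
              (cupProduct (rfl : 2 * 1 + 2 * 2 = 2 * 1 + 2 * 2)
                (complexBetti.map (SemiCartesianMonoidalCategory.snd X Y) (2 * 1) y)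
                (C.ch (X ⊗ Y) G 2)) =
            (-(m : ℂ)) • Ψ y) ∧
          ∃ (A : HodgeModel (2 + 2) (X ⊗ Y))
            (𝓕 : AnalytifiedVectorBundle 𝓘(ℂ, A.model) (EuclideanSpace ℂ (Fin rk)) A.toComplexPoints
              G)
            (gm : Bundle.ContMDiffRiemannianMetric 𝓘(ℝ, A.model) ∞ A.model
              (fun x : A.carrier ↦ TangentSpace 𝓘(ℝ, A.model) x))
            (J K : ∀ x : A.carrier, TangentSpace 𝓘(ℝ, A.model) x →L[ℝ] TangentSpace 𝓘(ℝ, A.model) x)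
            (hHK : IsHyperkaehlerTriple gm.toRiemannianMetric J K)
            (hω : isSmoothForm_kaehlerForm_of_isManifold_complex (E := A.model) (M := A.carrier))
            (e : DeRhamIsoFamily 𝓘(ℝ, A.model)),
            e.IsNatural ∧
            A.pullback 2
                (complexBetti.map (SemiCartesianMonoidalCategory.fst X Y) (2 * 1) (Ψ ω') +
                  complexBetti.map (SemiCartesianMonoidalCategory.snd X Y) (2 * 1) (ω')) =
              ofRealClass A.carrier 2 (e A.carrier 2 (gm.kaehlerClass hω hHK.isKaehler)) ∧
            HasHyperholomorphicConnection (EuclideanSpace ℂ (Fin rk)) 𝓕.bundle J K) :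
    IsEmpty ChernCharacterBetti :=
  ⟨fun C ↦ typedNikulinSerreCarrier_twistFamily_false C
    (H twistFamily (OrientationFamily.hasPoincareDuality _) C)⟩

end Summit.HodgeConjecture.HodgeConjecture.Theorems.NikulinSerreCarrier.Negative.TypedCruxFalse

end
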